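import Literature.AnabelianGeometry.SemiGraphs.SurfaceTypeSubCoverticialObject
import Literature.GroupTheory.CombinatorialGroupTheory.PuncturedSurfaceGroupFiniteIndexSubgroupHolds
import Literature.AnabelianGeometry.SemiGraphs.SurfaceTypeTotallyElevated
import Literature.AnabelianGeometry.SemiGraphs.ProSigmaCuspInertiaMalnormalHolds
import Literature.AnabelianGeometry.SemiGraphs.SurfaceTypeSlim
import Literature.AnabelianGeometry.SemiGraphs.ProSigmaClosedSurfaceSlimCore
import HarnessLib

/-!
# [SemiAnbd] Example 2.10, conjunct (3) unconditionally — and the named fact `example_2_10` PROVED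

Mochizuki, *Semi-graphs of anabelioids*, Publ. RIMS **42** (2006), Ex. 2.10 p. 31.
[cite: MochizukiSemiAnbd2006, Ex. 2.10 p.31]

PROOF-ONLY (cell abc-iut, layer L3, row G31 (3), seat abc-iut-w5-d195).  `SurfaceTypeSubCoverticialObject.lean`
proves conjunct (3) of `example_2_10` granted the classical fact `PuncturedSurfaceGroupFiniteIndexSubgroup`
(finite-index subgroups of punctured surface groups, Hoare–Karrass–Solitar 1971 / ZVC LNM 835 Thm 4.14.1),
which enters only through the stability of surface type under finite étale coverings.  That fact is a
THEOREM of the tree: `puncturedSurfaceGroupFiniteIndexSubgroup_holds` (`PuncturedSurfaceGroupFiniteIndexSubgroupHolds.lean`,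
the assembly of abc-iut-w5-d195 fed with `exists_schreierRibbonGraph`, abc-iut-w5-d186, and
`RibbonGraph.exists_puncturedSurfaceGroup_mulEquiv_of_faceSystem`, abc-iut-w5-d160) — so conjunct (3) holds
outright: `IsOfSurfaceType.isTotallyUniversallySubCoverticial`, `example_2_10_subCoverticial`.

With the four conjuncts already in the tree — (1) `example_2_10_coherent_of` (`SurfaceTypeQuasiCoherent`,
abc-iut-L3-t4), (2) `example_2_10_totallyElevated_of` (`SurfaceTypeTotallyElevated`, abc-iut-L3-t4),
(4) `example_2_10_totallyEstranged` (`ProSigmaCuspInertiaMalnormalHolds`, abc-iut-w5-d016 / w5-d051),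
(5) `isVerticiallySlim_of_isOfSurfaceType proSigmaSurfaceGroupSlim_holds` (`SurfaceTypeSlim`, abc-iut-L3-t11;
`ProSigmaClosedSurfaceSlimCore`, abc-iut-w5-d116) — this ASSEMBLES `example_2_10_holds : example_2_10`: the
named fact [SemiAnbd] Example 2.10 (`Coverticial.lean`, abc-iut-L3-t1) is a theorem of the tree.
-/

namespace Literature.AnabelianGeometry.SemiGraphs

namespace SemiGraphOfAnabelioids

open Literature.GroupTheory.CombinatorialGroupTheory

universe v₁ u₁ u

variable {𝒢 : SemiGraphOfAnabelioids.{v₁, u₁, u}} {Sigma : Set ℕ}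

/-- **[SemiAnbd] Ex. 2.10 (3): a semi-graph of anabelioids of surface type is totally universally
sub-coverticial** (unconditional). [cite: MochizukiSemiAnbd2006, Ex. 2.10 p.31] -/
theorem IsOfSurfaceType.isTotallyUniversallySubCoverticial (hS : 𝒢.IsOfSurfaceType Sigma) :
    𝒢.IsTotallyUniversallySubCoverticial :=
  hS.isTotallyUniversallySubCoverticial_of puncturedSurfaceGroupFiniteIndexSubgroup_holds

/-- **[SemiAnbd] Ex. 2.10, conjunct (3), in the exact shape of `example_2_10`** (the hypothesis
`EveryEdgeAbuts` is not used by this conjunct). [cite: MochizukiSemiAnbd2006, Ex. 2.10 p.31] -/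
theorem example_2_10_subCoverticial :
    ∀ (𝒢 : SemiGraphOfAnabelioids.{v₁, u₁, u}) (Sigma : Set ℕ), 𝒢.EveryEdgeAbuts →
      𝒢.IsOfSurfaceType Sigma → 𝒢.IsTotallyUniversallySubCoverticial :=
  fun _ _ _ hS => hS.isTotallyUniversallySubCoverticial

/-- **[SemiAnbd] Example 2.10 (Stable Curves) — the named fact `example_2_10` PROVED**: a semi-graph of
anabelioids of surface type in which every edge abuts to a vertex is coherent, totally elevated,
totally universally sub-coverticial, totally estranged and verticially slim; assembled from the five
conjuncts (1) `example_2_10_coherent_of`, (2) `example_2_10_totallyElevated_of`,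
(3) `IsOfSurfaceType.isTotallyUniversallySubCoverticial`, (4) `example_2_10_totallyEstranged`,
(5) `isVerticiallySlim_of_isOfSurfaceType proSigmaSurfaceGroupSlim_holds`.
[cite: MochizukiSemiAnbd2006, Ex. 2.10 p.31] -/
theorem example_2_10_holds :
    Literature.AnabelianGeometry.SemiGraphs.SemiGraphOfAnabelioids.example_2_10.{v₁, u₁, u} :=
  fun 𝒢 Sigma hE hS =>
    ⟨example_2_10_coherent_of 𝒢 Sigma hE hS, example_2_10_totallyElevated_of 𝒢 Sigma hE hS,
      hS.isTotallyUniversallySubCoverticial, example_2_10_totallyEstranged 𝒢 Sigma hS,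
      isVerticiallySlim_of_isOfSurfaceType proSigmaSurfaceGroupSlim_holds 𝒢 Sigma hS⟩

end SemiGraphOfAnabelioids

end Literature.AnabelianGeometry.SemiGraphs
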